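import Summits.Ventures.HSemireg.WedgePointPairPowersKernelOneOneCurves

/-!
# Venture HSemireg — the PLANE KERNEL THEOREM for the `n`-fold box of `m`-dimensional point pairs: on the `(a,b)`-plane of `⋀^{a+b}`
# (`a` `X`-letters, `b` `Y`-letters) with `min(a,b) < m` the kernel of `θ ↦ θ ∧ F` is the span of the KILLED monomials (every `m`, `n`)

HONEST FRAMING. Part of the Lean index of the computation cell `pub-hsemireg` (seat p10 gen 7, Sunday typer «UNIFORM-IN-n»).
Finite-dimensional EXTERIOR ALGEBRA over a field ONLY: no variety, no cohomology theory, no sheaf, no Ext group, no Hodge structure and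
no semiregularity map is constructed here; nothing here says that HC / HC_CM / HC_AV holds; no Literature fact is declared or used.
Custodian versions cited: STRUCTURE.md v1.0-SIGNED 9b196a05977dd067 §1.1 C4 / C5 / C10 (the kernel NAMES «split directions»,
«collapsed line (σ̄₀, 0, η₀)_i»); theory/FORMULA-N.md PART A §2.2, §4.2 (th-6).

Model as in `WedgePointPairPowers*.lean` (generators `Fin ((m+m)·n)`, blocks `X_i ⊔ Y_i`, `F = Π_i (a·E_{X_i} + c·E_{Y_i})`).  The
BIDEGREE of a monomial `E_s` is `(xdeg s, ydeg s)` = (number of `X`-letters, number of `Y`-letters); in the QUOTED dictionary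
(`X ↔ H⁰(T)`-type, `Y ↔ H¹(𝒪)`-type directions; NOT asserted) the `(a,b)`-PLANE `span{E_s : xdeg s = a, ydeg s = b}` is the Hodge piece
`H^b(∧^a T_Y)` of `HT^{a+b}(Y)`.  p10 g7's `WedgePointPairPowersKernelOneOne[Curves]` treated the `(1,1)`-plane.  THIS FILE, uniformly:
* §1 `xdeg`, `ydeg`, the `(a,b)`-sets `plSet`, the plane `plane a b` (`finrank_plane = #plSet`), the restricted map `phiPl`; a full
  half `Y_i` inside `s` forces `ydeg s ≥ m`, a full half `X_i` forces `xdeg s ≥ m` (`le_ydeg_of_pb_eq_Ys`, `le_xdeg_of_pb_eq_Xs`);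
* §2 **when `min(a,b) < m` the canonical representative (`WedgePointPairPowersKernelCollapse.canon`) is INJECTIVE on the alive
  `(a,b)`-sets** (`canon_injOn_alivePl`): for `b < m` no block part is `Y_i`, so `canon s = s`; for `a < m` no block part is `X_i`,
  so `s` is recovered from `canon s` by flipping back every full `X`-block;
* §3 hence the images `E_s ∧ F` of the alive `(a,b)`-sets are non-zero multiples of DISTINCT class vectors, linearly independent
  (`linearIndependent_alivePl`, via `linearIndependent_canon`'s ingredients);
* §4 **THE PLANE KERNEL THEOREM `map_ker_phiPl_eq_span_killed`**: for every field, `m ≥ 1`, `n`, `a`, `b` with `a < m ∨ b < m`, and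
  `a', c ≠ 0`: `ker(θ ↦ θ ∧ F ∣ (a,b)-plane) = span{E_s : s a KILLED (a,b)-set}`; **`finrank_ker_phiPl = #killed(a,b)`**,
  **`finrank_range_phiPl = #alive(a,b)`**;
* §5 consequences: on the PURE planes `(a,0)` (polyvector type `H⁰(∧^a T)`) and `(0,b)` (type `H^b(𝒪)`) nothing is killed, so `θ ↦ θ ∧ F`
  is INJECTIVE there for EVERY `a`, `b` (`finrank_ker_phiPl_pureX/Y`); in particular in degree `m` the `n` collapsed kernel lines
  `E_{Y_i} − λ·E_{X_i}` of `WedgePointPairPowersKernelCollapse.finrank_ker_wedge_pairBox_self` lie in NO single plane: they straddle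
  `(0,m) ⊕ (m,0)` — in the quoted dictionary (surfaces, `m = 2`) a vector `(σ̄₀, 0, η₀) ∈ H⁰(∧²T) ⊕ H¹(T) ⊕ H²(𝒪)` with
  zero middle component, which is STRUCTURE C10's notation for the collapsed line.  Every plane of total degree `< 2m` satisfies `min(a,b) < m`, so
  below degree `2m` plane kernels are killed-spans; the `(1,1)`-plane for `m ≥ 2` is `WedgePointPairPowersKernelOneOne`'s case, and
  `m = 1`, `(a,b) = (1,1)` (both `≥ m`) is exactly the exception of `…Curves` (`C(n+1,2)` instead of `n`).
* §6 EVERY plane, no hypothesis: **`finrank_range_phiPl_all`: rank on the `(a,b)`-plane = the number of DISTINCT canonical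
  representatives of its alive sets** (`canonImg`; images of one class are proportional, distinct classes independent), so
  `dim ker = #(a,b)-sets − |canon(alive)|` (`finrank_ker_phiPl_all`): the killed sets plus one relation per extra member of a class.
NOT here: a closed count of `|canon(alive (a,b)-sets)|` when `a, b ≥ m`; the Ext side; anything non-split.
Namespace `Summit.Ventures.HSemireg.Wedge.PairPowers`; new names only.
-/

open Module Set Set.powersetCard Polynomial

namespace Summit.Ventures.HSemireg.Wedge.PairPowers

open Summit.Ventures.HSemireg.Wedge Summit.Ventures.HSemireg.Wedge.Kunneth

variable (K : Type*) [Field K] {m n : ℕ}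

/-! ## §1. Bidegrees, `(a,b)`-sets and `(a,b)`-planes -/

variable (m n) in
/-- the number of `X`-letters of `s` (quoted: the polyvector degree `a` of `H^b(∧^a T)`). -/
def xdeg (s : Finset (Fin ((m + m) * n))) : ℕ := (s ∩ XX m n).card

variable (m n) in
/-- the number of `Y`-letters of `s` (quoted: the cohomological degree `b` of `H^b(∧^a T)`). -/
def ydeg (s : Finset (Fin ((m + m) * n))) : ℕ := (s \ XX m n).card

/-- `xdeg + ydeg = |s|`. -/
lemma xdeg_add_ydeg (s : Finset (Fin ((m + m) * n))) : xdeg m n s + ydeg m n s = s.card := by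
  rw [xdeg, ydeg, Finset.card_inter_add_card_sdiff]

variable (m n) in
/-- the `(a,b)`-SETS: `a` `X`-letters and `b` `Y`-letters. -/
def plSet (a b : ℕ) : Finset (Finset (Fin ((m + m) * n))) := Finset.univ.filter fun s => xdeg m n s = a ∧ ydeg m n s = b

/-- membership in `plSet`. -/
lemma mem_plSet {a b : ℕ} {s : Finset (Fin ((m + m) * n))} : s ∈ plSet m n a b ↔ xdeg m n s = a ∧ ydeg m n s = b := by
  simp [plSet]

/-- an `(a,b)`-set has `a + b` letters. -/
lemma card_of_mem_plSet {a b : ℕ} {s : Finset (Fin ((m + m) * n))} (hs : s ∈ plSet m n a b) : s.card = a + b := by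
  rw [← xdeg_add_ydeg, (mem_plSet.mp hs).1, (mem_plSet.mp hs).2]

variable (m n) in
/-- the `(a,b)`-PLANE: the span of the `(a,b)`-monomials (quoted: `H^b(∧^a T_Y)`). -/
noncomputable def plane (a b : ℕ) : Submodule K (HT K (Fin ((m + m) * n))) :=
  Submodule.span K (Set.range fun s : plSet m n a b => B K (Fin ((m + m) * n)) s.1)

/-- `dim (a,b)-plane = #(a,b)-sets`. -/
theorem finrank_plane (a b : ℕ) : finrank K (plane K m n a b) = (plSet m n a b).card := by
  rw [plane, finrank_span_eq_card, Fintype.card_coe]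
  exact (B K (Fin ((m + m) * n))).linearIndependent.comp (fun s : plSet m n a b => s.1) Subtype.val_injective

/-- `θ ↦ θ ∧ F` restricted to the `(a,b)`-plane. -/
noncomputable def phiPl (a b : ℕ) (a' c : K) : plane K m n a b →ₗ[K] HT K (Fin ((m + m) * n)) :=
  LinearMap.mulRight K (pairBox K (m := m) (n := n) a' c) ∘ₗ (plane K m n a b).subtype

/-- the restricted map on a vector of the plane. -/
lemma phiPl_apply (a b : ℕ) (a' c : K) (v : plane K m n a b) :
    phiPl K a b a' c v = (v : HT K (Fin ((m + m) * n))) * pairBox K (m := m) (n := n) a' c := rfl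

variable (m n) in
/-- the ALIVE `(a,b)`-sets. -/
def alivePl (a b : ℕ) : Finset (Finset (Fin ((m + m) * n))) :=
  (plSet m n a b).filter fun s => ∀ i : Fin n, Disjoint (pb m n i s) (Ys m) ∨ Disjoint (pb m n i s) (Xs m)

variable (m n) in
/-- the KILLED `(a,b)`-sets (some block part meets both halves). -/
def killedPl (a b : ℕ) : Finset (Finset (Fin ((m + m) * n))) :=
  (plSet m n a b).filter fun s => ¬ ∀ i : Fin n, Disjoint (pb m n i s) (Ys m) ∨ Disjoint (pb m n i s) (Xs m)

/-- membership in `alivePl`. -/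
lemma mem_alivePl {a b : ℕ} {s : Finset (Fin ((m + m) * n))} :
    s ∈ alivePl m n a b ↔ s ∈ plSet m n a b ∧ ∀ i : Fin n, Disjoint (pb m n i s) (Ys m) ∨ Disjoint (pb m n i s) (Xs m) :=
  Finset.mem_filter

/-- membership in `killedPl`. -/
lemma mem_killedPl {a b : ℕ} {s : Finset (Fin ((m + m) * n))} :
    s ∈ killedPl m n a b ↔ s ∈ plSet m n a b ∧ ¬ ∀ i : Fin n, Disjoint (pb m n i s) (Ys m) ∨ Disjoint (pb m n i s) (Xs m) :=
  Finset.mem_filter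

/-- `#alive(a,b) + #killed(a,b) = #(a,b)-sets`. -/
lemma card_alivePl_add_card_killedPl (a b : ℕ) : (alivePl m n a b).card + (killedPl m n a b).card = (plSet m n a b).card :=
  Finset.card_filter_add_card_filter_not _

/-- **a full half `Y_i` inside `s` forces `ydeg s ≥ m`** (its `m` letters are `Y`-letters of `s`). -/
lemma le_ydeg_of_pb_eq_Ys {s : Finset (Fin ((m + m) * n))} {i : Fin n} (h : pb m n i s = Ys m) : m ≤ ydeg m n s := by
  have hsub : lift m n i (Ys m) ⊆ s \ XX m n := by
    intro z hz
    obtain ⟨j, hj, rfl⟩ := mem_lift.mp hz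
    rw [Finset.mem_sdiff]
    refine ⟨mem_pb.mp (by rw [h]; exact hj), fun hX => ?_⟩
    exact Finset.disjoint_left.mp (WedgePair.disjoint_XY m) ((blockEmb_mem_XX_iff i j).mp hX) hj
  have h1 := Finset.card_le_card hsub
  rwa [card_lift, WedgePair.card_Yset] at h1

/-- **a full half `X_i` inside `s` forces `xdeg s ≥ m`**. -/
lemma le_xdeg_of_pb_eq_Xs {s : Finset (Fin ((m + m) * n))} {i : Fin n} (h : pb m n i s = Xs m) : m ≤ xdeg m n s := by
  have hsub : lift m n i (Xs m) ⊆ s ∩ XX m n := by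
    intro z hz
    obtain ⟨j, hj, rfl⟩ := mem_lift.mp hz
    exact Finset.mem_inter.mpr ⟨mem_pb.mp (by rw [h]; exact hj), (blockEmb_mem_XX_iff i j).mpr hj⟩
  have h1 := Finset.card_le_card hsub
  rwa [card_lift, WedgePair.card_Xset] at h1

/-! ## §2. For `min(a,b) < m` the canonical representative is injective on the alive `(a,b)`-sets -/

/-- no `Y`-half among the block parts: `canon s = s`. -/
lemma canon_eq_self_of_forall_ne {s : Finset (Fin ((m + m) * n))} (h : ∀ i, pb m n i s ≠ Ys m) : canon s = s :=
  eq_of_pb_eq fun i => by rw [pb_canon, if_neg (h i)]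

/-- `b < m`: an `(a,b)`-set has no full `Y`-half, so it is its own canonical representative. -/
lemma canon_eq_self_of_ydeg_lt {s : Finset (Fin ((m + m) * n))} (hb : ydeg m n s < m) : canon s = s :=
  canon_eq_self_of_forall_ne fun i h => absurd (le_ydeg_of_pb_eq_Ys h) (by omega)

/-- `a < m`: two sets without full `X`-halves and with the same canonical representative are equal (flip back every full
`X`-block of the representative). -/
lemma eq_of_canon_eq_of_xdeg_lt {s s' : Finset (Fin ((m + m) * n))} (ha : xdeg m n s < m) (ha' : xdeg m n s' < m)
    (h : canon s = canon s') : s = s' := by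
  refine eq_of_pb_eq fun i => ?_
  have hi := congr_arg (pb m n i) h
  rw [pb_canon, pb_canon] at hi
  by_cases h1 : pb m n i s = Ys m <;> by_cases h2 : pb m n i s' = Ys m
  · rw [h1, h2]
  · rw [if_pos h1, if_neg h2] at hi
    exact absurd (le_xdeg_of_pb_eq_Xs hi.symm) (by omega)
  · rw [if_neg h1, if_pos h2] at hi
    exact absurd (le_xdeg_of_pb_eq_Xs hi) (by omega)
  · rwa [if_neg h1, if_neg h2] at hi

/-- **`min(a,b) < m`: `canon` is injective on the alive `(a,b)`-sets**. -/
theorem canon_injOn_alivePl {a b : ℕ} (hab : a < m ∨ b < m) {s s' : Finset (Fin ((m + m) * n))} (hs : s ∈ alivePl m n a b)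
    (hs' : s' ∈ alivePl m n a b) (h : canon s = canon s') : s = s' := by
  obtain ⟨hx, hy⟩ := mem_plSet.mp (mem_alivePl.mp hs).1
  obtain ⟨hx', hy'⟩ := mem_plSet.mp (mem_alivePl.mp hs').1
  rcases hab with ha | hb
  · exact eq_of_canon_eq_of_xdeg_lt (by omega) (by omega) h
  · rwa [canon_eq_self_of_ydeg_lt (by omega : ydeg m n s < m), canon_eq_self_of_ydeg_lt (by omega : ydeg m n s' < m)] at h

/-! ## §3. Images of the alive `(a,b)`-sets are independent (`min(a,b) < m`) -/

/-- the canonical representative of an alive set, as a canonical alive `(a+b)`-set (`m ≥ 1`). -/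
def canonPl (hm : 1 ≤ m) {a b : ℕ} (s : alivePl m n a b) : canonSet m n (a + b) :=
  ⟨canon s.1, mem_canonSet.mpr ⟨⟨by rw [card_canon, card_of_mem_plSet (mem_alivePl.mp s.2).1], alive_canon (mem_alivePl.mp s.2).2⟩,
    pb_canon_ne_Ys hm s.1⟩⟩

/-- `canonPl` is injective when `min(a,b) < m`. -/
lemma canonPl_injective (hm : 1 ≤ m) {a b : ℕ} (hab : a < m ∨ b < m) : Function.Injective (canonPl (n := n) hm (a := a) (b := b)) :=
  fun s s' h => Subtype.ext (canon_injOn_alivePl hab s.2 s'.2 (congr_arg Subtype.val h))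

/-- **the image of an alive `(a,b)`-set is a non-zero multiple of the class vector of its canonical representative**. -/
lemma B_mul_pairBox_eq_smul_vec_canonPl (hm : 1 ≤ m) {a' c : K} (ha : a' ≠ 0) (hc : c ≠ 0) {a b : ℕ} (s : alivePl m n a b) :
    ∃ ν : K, ν ≠ 0 ∧ B K (Fin ((m + m) * n)) s.1 * pairBox K (m := m) (n := n) a' c = ν • vec K a' c (cSrc (canonPl hm s)) := by
  obtain ⟨hl, e⟩ := ccoef_spec K hm ha hc s.1
  obtain ⟨μ, hμ, e'⟩ := B_mul_pairBox_eq_smul_vec_cSrc K hm ha hc (canonPl hm s)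
  refine ⟨ccoef K a' c s.1 * μ, mul_ne_zero hl hμ, ?_⟩
  rw [e, ← smul_smul, ← e']
  rfl

/-- **the images `E_s ∧ F` of the alive `(a,b)`-sets are linearly independent when `min(a,b) < m`** (`m ≥ 1`, `a', c ≠ 0`). -/
theorem linearIndependent_alivePl (hm : 1 ≤ m) {a' c : K} (ha : a' ≠ 0) (hc : c ≠ 0) {a b : ℕ} (hab : a < m ∨ b < m) :
    LinearIndependent K (fun s : alivePl m n a b => B K (Fin ((m + m) * n)) s.1 * pairBox K (m := m) (n := n) a' c) := by
  apply SurfacePowers.linearIndependent_of_disjoint_support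
  · intro s
    obtain ⟨ν, hν, e⟩ := B_mul_pairBox_eq_smul_vec_canonPl K hm ha hc s
    rw [e]
    exact smul_ne_zero hν (vec_ne_zero K hm ha hc _)
  · intro s s' hne T
    obtain ⟨ν, -, e⟩ := B_mul_pairBox_eq_smul_vec_canonPl K hm ha hc s
    obtain ⟨ν', -, e'⟩ := B_mul_pairBox_eq_smul_vec_canonPl K hm ha hc s'
    rw [e, e', map_smul, map_smul, smul_eq_mul, smul_eq_mul]
    rcases coord_vec_eq_zero_or K hm ha hc (fun h => hne (canonPl_injective hm hab (cSrc_injective h))) T with h0 | h0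
    · exact Or.inl (by rw [h0, mul_zero])
    · exact Or.inr (by rw [h0, mul_zero])

/-! ## §4. The plane kernel theorem -/

/-- **THE PLANE KERNEL THEOREM.**  For every field, `m ≥ 1`, `n`, bidegree `(a,b)` with `a < m ∨ b < m`, and `a', c ≠ 0`: the kernel of
`θ ↦ θ ∧ F` on the `(a,b)`-plane of `⋀^{a+b} K^{(m+m)n}` is the span of the KILLED `(a,b)`-monomials (as a subspace of `⋀ K^{(m+m)n}`). -/
theorem map_ker_phiPl_eq_span_killed (hm : 1 ≤ m) {a' c : K} (ha : a' ≠ 0) (hc : c ≠ 0) {a b : ℕ} (hab : a < m ∨ b < m) :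
    (LinearMap.ker (phiPl K (m := m) (n := n) a b a' c)).map (plane K m n a b).subtype =
      Submodule.span K (Set.range fun s : killedPl m n a b => B K (Fin ((m + m) * n)) s.1) := by
  apply le_antisymm
  · rintro _ ⟨v, hv, rfl⟩
    rw [SetLike.mem_coe, LinearMap.mem_ker, phiPl_apply] at hv
    set cv := (B K (Fin ((m + m) * n))).repr (v : HT K (Fin ((m + m) * n))) with hcv
    have hw : (v : HT K (Fin ((m + m) * n))) ∈
        Submodule.span K ((fun s => B K (Fin ((m + m) * n)) s) '' (plSet m n a b : Set (Finset (Fin ((m + m) * n))))) := by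
      rw [Set.image_eq_range]
      exact v.2
    have hsupp : ↑cv.support ⊆ (plSet m n a b : Set (Finset (Fin ((m + m) * n)))) := (B K _).mem_span_image.mp hw
    have hexp : (v : HT K (Fin ((m + m) * n))) = ∑ s ∈ plSet m n a b, cv s • B K (Fin ((m + m) * n)) s := by
      rw [← Finsupp.linearCombination_apply_of_mem_supported K ((Finsupp.mem_supported K cv).mpr hsupp), hcv,
        Basis.linearCombination_repr]
    have hsum : ∑ s ∈ alivePl m n a b, cv s • (B K (Fin ((m + m) * n)) s * pairBox K (m := m) (n := n) a' c) = 0 := by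
      calc ∑ s ∈ alivePl m n a b, cv s • (B K (Fin ((m + m) * n)) s * pairBox K (m := m) (n := n) a' c)
          = ∑ s ∈ plSet m n a b, cv s • (B K (Fin ((m + m) * n)) s * pairBox K (m := m) (n := n) a' c) := by
            rw [alivePl, Finset.sum_filter]
            refine Finset.sum_congr rfl fun s _ => ?_
            split_ifs with h
            · rfl
            · rw [B_mul_pairBox_eq_zero_of_not_alive K hm ha hc h, smul_zero]
        _ = (v : HT K (Fin ((m + m) * n))) * pairBox K (m := m) (n := n) a' c := by
            rw [hexp, Finset.sum_mul]
            exact Finset.sum_congr rfl fun s _ => (smul_mul_assoc _ _ _).symm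
        _ = 0 := hv
    have hzero : ∀ s ∈ alivePl m n a b, cv s = 0 := by
      have h := Fintype.linearIndependent_iff.mp (linearIndependent_alivePl K hm ha hc hab) (fun s => cv s.1)
        (by rw [← Finset.sum_coe_sort] at hsum; exact hsum)
      exact fun s hs => h ⟨s, hs⟩
    show (v : HT K (Fin ((m + m) * n))) ∈ _
    rw [hexp]
    refine Submodule.sum_mem _ fun s hs => ?_
    by_cases h : ∀ i : Fin n, Disjoint (pb m n i s) (Ys m) ∨ Disjoint (pb m n i s) (Xs m)
    · rw [hzero s (mem_alivePl.mpr ⟨hs, h⟩), zero_smul]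
      exact Submodule.zero_mem _
    · exact Submodule.smul_mem _ _ (Submodule.subset_span ⟨⟨s, mem_killedPl.mpr ⟨hs, h⟩⟩, rfl⟩)
  · rw [Submodule.span_le]
    rintro _ ⟨⟨s, hs⟩, rfl⟩
    obtain ⟨hpl, hk⟩ := mem_killedPl.mp hs
    refine ⟨⟨B K (Fin ((m + m) * n)) s, Submodule.subset_span ⟨⟨s, hpl⟩, rfl⟩⟩, ?_, rfl⟩
    rw [SetLike.mem_coe, LinearMap.mem_ker, phiPl_apply]
    exact B_mul_pairBox_eq_zero_of_not_alive K hm ha hc hk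

/-- **`dim ker(θ ↦ θ ∧ F ∣ (a,b)-plane) = #killed(a,b)`** (`m ≥ 1`, `a < m ∨ b < m`, `a', c ≠ 0`). -/
theorem finrank_ker_phiPl (hm : 1 ≤ m) {a' c : K} (ha : a' ≠ 0) (hc : c ≠ 0) {a b : ℕ} (hab : a < m ∨ b < m) :
    finrank K (LinearMap.ker (phiPl K (m := m) (n := n) a b a' c)) = (killedPl m n a b).card := by
  rw [← Submodule.finrank_map_subtype_eq, map_ker_phiPl_eq_span_killed K hm ha hc hab, finrank_span_eq_card, Fintype.card_coe]
  exact (B K (Fin ((m + m) * n))).linearIndependent.comp (fun s : killedPl m n a b => s.1) Subtype.val_injective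

/-- **rank on the `(a,b)`-plane `= #alive(a,b)`** (`m ≥ 1`, `a < m ∨ b < m`): every alive `(a,b)`-monomial survives independently. -/
theorem finrank_range_phiPl (hm : 1 ≤ m) {a' c : K} (ha : a' ≠ 0) (hc : c ≠ 0) {a b : ℕ} (hab : a < m ∨ b < m) :
    finrank K (LinearMap.range (phiPl K (m := m) (n := n) a b a' c)) = (alivePl m n a b).card := by
  have h := LinearMap.finrank_range_add_finrank_ker (phiPl K (m := m) (n := n) a b a' c)
  rw [finrank_plane, finrank_ker_phiPl K hm ha hc hab, ← card_alivePl_add_card_killedPl] at h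
  omega

/-! ## §5. Pure planes: nothing is killed, `θ ↦ θ ∧ F` is injective -/

/-- a set without `Y`-letters is alive (each block part lies in `X_i`). -/
lemma alive_of_ydeg_eq_zero {s : Finset (Fin ((m + m) * n))} (h : ydeg m n s = 0) (i : Fin n) :
    Disjoint (pb m n i s) (Ys m) ∨ Disjoint (pb m n i s) (Xs m) := by
  rw [ydeg, Finset.card_eq_zero, Finset.sdiff_eq_empty_iff_subset] at h
  refine Or.inl (WedgePair.disjoint_Y_iff_subset_X.mpr fun j hj => ?_)
  exact (blockEmb_mem_XX_iff i j).mp (h (mem_pb.mp hj))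

/-- a set without `X`-letters is alive (each block part lies in `Y_i`). -/
lemma alive_of_xdeg_eq_zero {s : Finset (Fin ((m + m) * n))} (h : xdeg m n s = 0) (i : Fin n) :
    Disjoint (pb m n i s) (Ys m) ∨ Disjoint (pb m n i s) (Xs m) := by
  rw [xdeg, Finset.card_eq_zero] at h
  refine Or.inr (WedgePair.disjoint_X_iff_subset_Y.mpr fun j hj => ?_)
  have hz : blockEmb m n i j ∉ XX m n := fun hX => Finset.notMem_empty _ (h ▸ Finset.mem_inter.mpr ⟨mem_pb.mp hj, hX⟩)
  have h1 := (blockEmb_mem_XX_iff i j).not.mp hz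
  rw [WedgePair.mem_Xset, not_lt] at h1
  rw [WedgePair.mem_Yset]
  exact h1

/-- no `(a,0)`-set is killed … -/
lemma killedPl_pureX (a : ℕ) : killedPl m n a 0 = ∅ :=
  Finset.eq_empty_of_forall_notMem fun _ hs => (mem_killedPl.mp hs).2 (alive_of_ydeg_eq_zero (mem_plSet.mp (mem_killedPl.mp hs).1).2)

/-- … and no `(0,b)`-set. -/
lemma killedPl_pureY (b : ℕ) : killedPl m n 0 b = ∅ :=
  Finset.eq_empty_of_forall_notMem fun _ hs => (mem_killedPl.mp hs).2 (alive_of_xdeg_eq_zero (mem_plSet.mp (mem_killedPl.mp hs).1).1)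

/-- **`θ ↦ θ ∧ F` is INJECTIVE on every pure-`X` plane `(a,0)`** (quoted: on `H⁰(∧^a T_Y)`), every `m ≥ 1`, `n`, `a`, `a', c ≠ 0`. -/
theorem finrank_ker_phiPl_pureX (hm : 1 ≤ m) {a' c : K} (ha : a' ≠ 0) (hc : c ≠ 0) (a : ℕ) :
    finrank K (LinearMap.ker (phiPl K (m := m) (n := n) a 0 a' c)) = 0 := by
  rw [finrank_ker_phiPl K hm ha hc (Or.inr hm), killedPl_pureX, Finset.card_empty]

/-- **… and on every pure-`Y` plane `(0,b)`** (quoted: on `H^b(𝒪_Y)`): so in degree `m` the `n` collapsed kernel lines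
`E_{Y_i} − λ·E_{X_i}` (`WedgePointPairPowersKernelCollapse.finrank_ker_wedge_pairBox_self`) straddle `(0,m) ⊕ (m,0)` and lie in neither —
STRUCTURE C10's `(σ̄₀, 0, η₀)`. -/
theorem finrank_ker_phiPl_pureY (hm : 1 ≤ m) {a' c : K} (ha : a' ≠ 0) (hc : c ≠ 0) (b : ℕ) :
    finrank K (LinearMap.ker (phiPl K (m := m) (n := n) 0 b a' c)) = 0 := by
  rw [finrank_ker_phiPl K hm ha hc (Or.inl hm), killedPl_pureY, Finset.card_empty]

/-! ## §6. Every plane: rank = number of distinct canonical representatives met -/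

variable (m n) in
/-- the canonical representatives of the alive `(a,b)`-sets (a set of canonical alive `(a+b)`-sets). -/
def canonImg (a b : ℕ) : Finset (Finset (Fin ((m + m) * n))) := (alivePl m n a b).image canon

/-- a representative met by the plane, as a canonical alive `(a+b)`-set (`m ≥ 1`). -/
def cImg (hm : 1 ≤ m) {a b : ℕ} (t : canonImg m n a b) : canonSet m n (a + b) :=
  ⟨t.1, by
    obtain ⟨s, hs, e⟩ := Finset.mem_image.mp t.2
    rw [← e]
    exact (canonPl hm ⟨s, hs⟩).2⟩

/-- `cImg` is injective. -/
lemma cImg_injective (hm : 1 ≤ m) {a b : ℕ} : Function.Injective (cImg (n := n) hm (a := a) (b := b)) := by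
  intro x y h
  have h1 := congr_arg Subtype.val h
  exact Subtype.ext h1

/-- **the range of `θ ↦ θ ∧ F` on ANY `(a,b)`-plane is the span of the images of the canonical representatives it meets**
(`m ≥ 1`, `a', c ≠ 0`; no hypothesis on `a`, `b`). -/
theorem range_phiPl_eq_span (hm : 1 ≤ m) {a' c : K} (ha : a' ≠ 0) (hc : c ≠ 0) (a b : ℕ) :
    LinearMap.range (phiPl K (m := m) (n := n) a b a' c) =
      Submodule.span K (Set.range fun t : canonImg m n a b => B K (Fin ((m + m) * n)) (cImg hm t).1 * pairBox K (m := m) (n := n) a' c) := by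
  apply le_antisymm
  · rw [phiPl, LinearMap.range_comp, Submodule.range_subtype, plane, Submodule.map_span, Submodule.span_le]
    rintro _ ⟨_, ⟨⟨s, hs⟩, rfl⟩, rfl⟩
    rw [SetLike.mem_coe, LinearMap.mulRight_apply]
    by_cases hal : ∀ i : Fin n, Disjoint (pb m n i s) (Ys m) ∨ Disjoint (pb m n i s) (Xs m)
    · obtain ⟨-, e⟩ := ccoef_spec K hm ha hc s
      rw [e]
      exact Submodule.smul_mem _ _ (Submodule.subset_span
        ⟨⟨canon s, Finset.mem_image.mpr ⟨s, mem_alivePl.mpr ⟨hs, hal⟩, rfl⟩⟩, rfl⟩)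
    · rw [B_mul_pairBox_eq_zero_of_not_alive K hm ha hc hal]
      exact Submodule.zero_mem _
  · rw [Submodule.span_le]
    rintro _ ⟨⟨t, ht⟩, rfl⟩
    obtain ⟨s, hs, e⟩ := Finset.mem_image.mp ht
    obtain ⟨hl, e'⟩ := ccoef_spec K hm ha hc s
    have hmem : B K (Fin ((m + m) * n)) s ∈ plane K m n a b := Submodule.subset_span ⟨⟨s, (mem_alivePl.mp hs).1⟩, rfl⟩
    refine ⟨(ccoef K a' c s)⁻¹ • ⟨_, hmem⟩, ?_⟩
    rw [map_smul, phiPl_apply, e', smul_smul, inv_mul_cancel₀ hl, one_smul]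
    exact congr_arg (fun u => B K (Fin ((m + m) * n)) u * pairBox K (m := m) (n := n) a' c) e

/-- **RANK ON ANY PLANE = NUMBER OF DISTINCT CANONICAL REPRESENTATIVES MET** (`m ≥ 1`, `a', c ≠ 0`, every `a`, `b`):
`rank(θ ↦ θ ∧ F ∣ (a,b)-plane) = |canon(alive (a,b)-sets)|`; for `min(a,b) < m` this is `#alive(a,b)` (§4), for `m = 1`,
`(a,b) = (1,1)` it is `C(n,2)` (`WedgePointPairPowersKernelOneOneCurves`). -/
theorem finrank_range_phiPl_all (hm : 1 ≤ m) {a' c : K} (ha : a' ≠ 0) (hc : c ≠ 0) (a b : ℕ) :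
    finrank K (LinearMap.range (phiPl K (m := m) (n := n) a b a' c)) = (canonImg m n a b).card := by
  rw [range_phiPl_eq_span K hm ha hc, finrank_span_eq_card, Fintype.card_coe]
  exact (linearIndependent_canon K hm ha hc (a + b)).comp (cImg hm) (cImg_injective hm)

/-- … so **`dim ker(θ ↦ θ ∧ F ∣ (a,b)-plane) = #(a,b)-sets − |canon(alive (a,b)-sets)|`** on every plane: the killed sets plus one
relation for every alive set beyond the first in each class met. -/
theorem finrank_ker_phiPl_all (hm : 1 ≤ m) {a' c : K} (ha : a' ≠ 0) (hc : c ≠ 0) (a b : ℕ) :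
    finrank K (LinearMap.ker (phiPl K (m := m) (n := n) a b a' c)) = (plSet m n a b).card - (canonImg m n a b).card := by
  have h := LinearMap.finrank_range_add_finrank_ker (phiPl K (m := m) (n := n) a b a' c)
  rw [finrank_plane, finrank_range_phiPl_all K hm ha hc] at h
  omega

end Summit.Ventures.HSemireg.Wedge.PairPowers
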